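import Summits.QuantumFields.YangMills.Theorems.BalabanUVNodesN15KingModelSlicesExactMass
import Summits.QuantumFields.YangMills.Theorems.BalabanUVNodesN15KingModelSlicesTorusGradNode
import Literature.MathematicalPhysics.QuantumFieldTheory.King1986.MinimizerTwoSpacingDerivUniform

/-!
# BalabanUVNodes ∕ N15 — THE KING-MODEL RUNG, CURVED EDITION (PART M′): THE GRADIENT PIECE OF KING'S SLICES WITH THE MASS
# QUANTIFIED INSIDE — (3.73) LINE 2 for the slices of (2.17) AT THEIR PHYSICAL MASSES `m²(L^jη)²`, hypothesis-free, one constant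
# pair; and the mass-uniform decay ∕ rate of the gradient piece that the full-propagator gradient induction (parts O-a′∕O-b′) consumes
# (Track A, DAG node N15 = NE2; FAN-OUT v1.1 §N15 s3 «KING-MODEL RUNG … + the one-line statement of what the curved case adds»)

HONEST FRAMING.  Count-neutral kernel bookkeeping (cell `pub-ymgap`, seat `pub-ymgap-dag-n15-e` g6; `--supports stmt-QuantumFields-19912
--as helper` = K3‴ `SpineGivenEndpointR13`, lineage K3 19676 → K3′ 19908).  TEMPLATE LITERATURE, `A = 0`: C. King's scalar U(1)-Higgs MODEL
on finite tori ([King1986] (2.17) p. 653, (2.20) p. 654, Prop. 3.8 (3.71) p. 664, Prop. 3.9 (3.73) p. 665, §4 p. 675 (4.42)–(4.43)), NOT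
Bałaban's covariant objects; NE2⁺ is NOT PRINTED for those and not proved here; NOT a node discharge; nothing continuum ∕ ℝ⁴ ∕ OS ∕
mass-gap ∕ Clay.  0 `sorry`, standard axioms; one `abbrev` (the exact-mass index of the datum with gradient, = part M's `kSliceIndexPhys`
with part I's `dG`).

THE POINT.  Part M (`…SlicesExactMass`) moved the mass inside the `∃ (C, δ)` for the slice kernel (line 1 of (3.73)) using
`King1986.MinimizerDecayUniform`; parts H∕I (`…SlicesTorusGrad(Node)`) proved line 2 (the gradient piece `ksDSlice = Σ(Σ ∂^ηℋ_j·C^{(j)})·ℋ_j`,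
= `∂^η_μ(G^ε_{j+1} − G^ε_j)` by part K `ksDSlice_eq_sub`) at a FIXED mass.  With `King1986.MinimizerTwoSpacingDerivUniform` (this seat:
`dminimiser_kernel_decay_blocks_unif`, `king_prop38_deriv_torus_blocks_unif`) the same re-run gives line 2 mass-uniformly:
* §1 `ksDH_decay_unif`, `ksDH_rate_unif`, **`ksDSlice_rate_unif`** (part H's (4.43)-with-one-differentiated-leg, ONE `(C, δ)` for every
  `0 < m² ≤ m₀²`, `0 ≤ γ < 1`), **`ksDSlice_decay_unif`** (decay of the gradient piece, both runs, via part M v1.1 `triple_decay`);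
* §2 the EXACT-MASS datum with gradient `kSliceIndexPhysD` (part I's `kSliceIndexD` at `physMass L m² i = m²(L^jη)²`), **`line2_kSlicesPhys`**
  ((3.73) line 2 at slice `j`, `p`-prefactor `(L^jη)^{1−(d+1)−γ′}`, one `(C, δ)` for all volumes ∕ slices ∕ ratios ∕ member masses),
  `line1_kSlicesPhysD` (line 1 for the same datum = part M's), **`ne2PlusSite_kSlicesPhys_grad`** (`NE2PlusSite (d+1) (−1) c35`, hypothesis-free,
  through part E v1.1 `ne2PlusSite_slicesDG_of_line2`), `ne2ZeroSite_kSlicesPhys_grad`, `ne2PlusSite_kSlicesPhys_both` (`p = −2` and `p = −1` at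
  once) — NE2's site layer, BOTH kernel lines of (3.73), for the gradient∕slice of EVERY slice of King's (2.17) at its physical mass.
HONEST SCOPE.  (i) `A = 0`, periodic b.c., odd `L ≥ 3`, `0 < m² ≤ m₀²`, cubes `2L^e`; (ii) lattice units (parts F–M); (iii) `0 ≤ γ < 1` for the
gradient (the tree's Prop. 3.8 second line); (iv) not the sum over slices (that is parts O-a′∕O-b′); (v) not Bałaban's `∇G_k(U)`; not a discharge.
Locators: [King1986] C. King, CMP **102** (1986) 649–677: (2.17) p. 653, (2.20) p. 654, Prop. 3.8 (3.71) p. 664, Prop. 3.9 (3.73) p. 665,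
(4.42)–(4.43) p. 675; [Ba 4] = [Balaban1983RegularityDecay] Theorem (1.10) p. 573 (clause 2); [B9] = [Balaban1985BackgroundPropagators]
Thm 3.2 (3.48) p. 398 + Thm 3.14 pp. 426–427 (quantifier template).
-/

noncomputable section

namespace Summit.QuantumFields.YangMills.BalabanUVNodes.N15KingModelRung.Curved

open Real Finset Matrix
open Literature.MathematicalPhysics.QuantumFieldTheory.Balaban1983to89 (Params)
open Literature.MathematicalPhysics.QuantumFieldTheory.Balaban1983to89.T4EtaRate (EtaRateIneqSite NE2PlusSite)
open Literature.MathematicalPhysics.QuantumFieldTheory.Balaban1983to89.T4EtaRateSiteOfRatePair (NE2ZeroSite ne2ZeroSite_of_ne2PlusSite)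
open Literature.MathematicalPhysics.QuantumFieldTheory.Balaban1983to89.B4Sect5Proof (latticeConst)
open Literature.MathematicalPhysics.QuantumFieldTheory.Balaban1983to89.B5Prop11Plancherel (Tor fine unitVec)
open Literature.MathematicalPhysics.QuantumFieldTheory.King1986 (aK aK_le aK_pos dprop38RateConst dprop38PosConst lemma43Const)
open Literature.MathematicalPhysics.QuantumFieldTheory.King1986.ContinuumLimit (eps eps_pos eps_le_one)
open Literature.MathematicalPhysics.QuantumFieldTheory.King1986.Torus (blockOf blockOf_over tdistT tdistT_triangle tdistT_nonneg tdistT_symm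
  tdistT_sumBound dminimiser_kernel_decay_blocks_unif king_prop38_deriv_torus_blocks_unif gam0L kapCT K45 delta45 K45_nonneg delta45_pos
  kapCT_pos_le)
open Literature.MathematicalPhysics.QuantumFieldTheory.King1986.SlicePropagator (SliceKernels TwoSpacing)
open Summit.QuantumFields.YangMills.BalabanUVNodes.N15.KingModel (kingRho kingRhoB)
open Summit.QuantumFields.YangMills.BalabanUVNodes.N18KingModelTorusDeriv (douterRate_le_unif)

variable {d : ℕ} (L : ℕ) [NeZero L]

/-! ## §1 Part H's factor bounds and assembly with the mass quantified inside -/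

/-- **DECAY OF THE DIFFERENTIATED LEGS, BOTH RUNS, UNIFORMLY IN THE INDEX AND IN THE MASS `0 ≤ m² ≤ m₀²`** ([Ba 4] (1.10) clause 2
mass-uniform, `dminimiser_kernel_decay_blocks_unif`, `a_K ≤ a`). [cite: King1986, Theorem 3.3 (3.7) p.658, Prop. 3.7 (3.63) p.663; Balaban1983RegularityDecay, Theorem (1.10) p.573] -/
theorem ksDH_decay_unif (hLodd : Odd L) (hL : 2 ≤ L) {a : ℝ} (ha : 0 < a) {m0sq : ℝ} (hm0 : 0 ≤ m0sq) :
    ∃ δ₀ c : ℝ, 0 < δ₀ ∧ 0 < c ∧ ∀ (m2 : ℝ), 0 ≤ m2 → m2 ≤ m0sq → ∀ (i : KSliceIdx d) (μ : Fin (d + 1)),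
      (∀ (x : Tor (fine (L ^ i.j) (ksU L i))) (z : Tor (ksU L i)),
        |ksDH L a m2 i μ x z| ≤ c * Real.exp (-(δ₀ * tdistT (ksU L i) (blockOf (L ^ i.j) (ksU L i) x) z))) ∧
      (∀ (x' : Tor (fine (L ^ i.n * L ^ i.j) (ksU L i))) (z : Tor (ksU L i)),
        |ksDH' L a m2 i μ x' z| ≤ c * Real.exp (-(δ₀ * tdistT (ksU L i) (blockOf (L ^ i.n * L ^ i.j) (ksU L i) x') z))) := by
  have hL1 : 1 < L := by omega
  have hLr : (1 : ℝ) < L := by exact_mod_cast hL1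
  obtain ⟨δ₀, c₀, hδ₀, hc₀, H⟩ := dminimiser_kernel_decay_blocks_unif (d + 1) L (Nat.succ_pos d) ⟨hLodd, hL1⟩ ha hm0
  refine ⟨δ₀, a * c₀, hδ₀, mul_pos ha hc₀, fun m2 hm hcap i μ => ⟨fun x z => ?_, fun x' z => ?_⟩⟩
  · have h := H (i.params L hLodd hL) rfl rfl i.one_le_j m2 hm hcap (ksU L i) (ksU_eq_sitesPerDir L hLodd hL i) (L ^ i.j) rfl x z μ
    refine h.trans (mul_le_mul_of_nonneg_right ?_ (Real.exp_pos _).le)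
    exact mul_le_mul_of_nonneg_right (aK_le ha hLr i.one_le_j) hc₀.le
  · have hjn : 1 ≤ i.j + i.n := by have := i.one_le_j; omega
    have h := H (i.paramsHi L hLodd hL) rfl rfl hjn m2 hm hcap (ksU L i) (ksU_eq_sitesPerDir_hi L hLodd hL i)
      (L ^ i.n * L ^ i.j) (by show L ^ i.n * L ^ i.j = L ^ (i.j + i.n); rw [pow_add, mul_comm]) x' z μ
    refine h.trans (mul_le_mul_of_nonneg_right ?_ (Real.exp_pos _).le)
    exact mul_le_mul_of_nonneg_right (aK_le ha hLr hjn) hc₀.le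

/-- **THE RATE OF THE DIFFERENTIATED LEG, UNIFORMLY IN THE INDEX AND IN THE MASS `0 < m² ≤ m₀²`** (Prop. 3.8 second line mass-uniform,
`king_prop38_deriv_torus_blocks_unif`, constant majorised in `(j, n)` by `douterRate_le_unif`; `0 ≤ γ < 1`). [cite: King1986, Prop. 3.8 (3.71) p.664 (second line), p.674] -/
theorem ksDH_rate_unif (hLodd : Odd L) (hL : 2 ≤ L) {a : ℝ} (ha : 0 < a) {m0sq : ℝ} (hm0 : 0 ≤ m0sq) {γ : ℝ} (hγ0 : 0 ≤ γ)
    (hγ1 : γ < 1) :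
    ∃ R δ : ℝ, 0 < R ∧ 0 < δ ∧ ∀ (m2 : ℝ), 0 < m2 → m2 ≤ m0sq →
      ∀ (i : KSliceIdx d) (μ : Fin (d + 1)) (x' : Tor (fine (L ^ i.n * L ^ i.j) (ksU L i))) (z : Tor (ksU L i)),
      |ksDH' L a m2 i μ x' z - ksDH L a m2 i μ (underPtN L i.j i.n (ksU L i) x') z|
        ≤ R * (((L : ℝ) ^ (-(γ / 2))) ^ i.j)
          * Real.exp (-(δ * tdistT (ksU L i) (blockOf (L ^ i.j) (ksU L i) (underPtN L i.j i.n (ksU L i) x')) z)) := by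
  obtain ⟨δ₀, c₀, hδ₀, hc₀, H⟩ := king_prop38_deriv_torus_blocks_unif (d + 1) L (Nat.succ_pos d) hLodd hL ha hm0 hγ0 hγ1
  set Cu : ℝ := dprop38RateConst a a (a * (2 * ((a * (1 - ((L : ℝ) ^ 2)⁻¹))⁻¹ + π ^ 2 / 48 + 1 / 3)))
      ((π ^ 2 / 4) ^ (d + 1)) (d + 1) γ + dprop38PosConst a ((π ^ 2 / 4) ^ (d + 1)) (d + 1) γ with hCu
  refine ⟨Real.sqrt (2 * (a * c₀) * Cu) + 1, δ₀ / 2, by positivity, half_pos hδ₀, fun m2 hm hcap i μ x' z => ?_⟩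
  have hj := H (i.params L hLodd hL) rfl rfl i.one_le_j m2 hm hcap i.n i.one_le_n (ksU L i) (ksU_eq_sitesPerDir L hLodd hL i)
    (underPtN L i.j i.n (ksU L i) x') x' z (val_underPtN L i.j i.n (ksU L i) x') μ
  set s : ℝ := (L : ℝ) ^ (-(γ / 2)) with hs_def
  have hs : 0 ≤ s := Real.rpow_nonneg (Nat.cast_nonneg _) _
  set E : ℝ := Real.exp (-(δ₀ / 2 * tdistT (ksU L i) (blockOf (L ^ i.j) (ksU L i) (underPtN L i.j i.n (ksU L i) x')) z)) with hE
  have hstep : |ksDH' L a m2 i μ x' z - ksDH L a m2 i μ (underPtN L i.j i.n (ksU L i) x') z| ≤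
      Real.sqrt ((dprop38RateConst a a (lemma43Const a L i.j i.n) ((π ^ 2 / 4) ^ (d + 1)) (d + 1) γ
            + dprop38PosConst a ((π ^ 2 / 4) ^ (d + 1)) (d + 1) γ) * ((L ^ i.j : ℕ) : ℝ) ^ (-γ) * (2 * (a * c₀))) * E := hj
  have hC := douterRate_le_unif (d := d + 1) (Nat.succ_pos d) ha hL i.one_le_j i.one_le_n hγ1 hc₀.le (K := i.j)
  calc |ksDH' L a m2 i μ x' z - ksDH L a m2 i μ (underPtN L i.j i.n (ksU L i) x') z|
      ≤ Real.sqrt ((dprop38RateConst a a (lemma43Const a L i.j i.n) ((π ^ 2 / 4) ^ (d + 1)) (d + 1) γ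
            + dprop38PosConst a ((π ^ 2 / 4) ^ (d + 1)) (d + 1) γ) * ((L ^ i.j : ℕ) : ℝ) ^ (-γ) * (2 * (a * c₀))) * E := hstep
    _ ≤ Real.sqrt (2 * (a * c₀) * Cu) * s ^ i.j * E := mul_le_mul_of_nonneg_right hC (Real.exp_pos _).le
    _ ≤ (Real.sqrt (2 * (a * c₀) * Cu) + 1) * s ^ i.j * E := by
        refine mul_le_mul_of_nonneg_right (mul_le_mul_of_nonneg_right (by linarith) (pow_nonneg hs _)) (Real.exp_pos _).le

/-- **THE η-RATE OF THE GRADIENT PIECE, ONE `(C, δ)` FOR ALL MASSES `0 < m² ≤ m₀²`** (part H's `ksDSlice_rate` — (4.43) with one differentiated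
leg — with the mass quantified inside): for every `0 < m² ≤ m₀²`, every index, direction and all fine `x′, y′` over `x, y`,
`|ksDSlice′_μ(x′, y′) − ksDSlice_μ(x, y)| ≤ C·(L^{−γ∕2})^j·e^{−δ|B(x) − B(y)|_U}`.  The proof is part H's, fed §1's and part M's mass-uniform factor
bounds; the middle factor's constants never depended on the mass. [cite: King1986, Prop. 3.9 (3.73) p.665 (second line, `A = 0`), (4.42)–(4.43) p.675, (2.20) p.654] -/
theorem ksDSlice_rate_unif (hLodd : Odd L) (hL : 2 ≤ L) {a : ℝ} (ha : 0 < a) {m0sq : ℝ} (hm0 : 0 ≤ m0sq) {γ : ℝ} (hγ0 : 0 ≤ γ)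
    (hγ1 : γ < 1) :
    ∃ C δ : ℝ, 0 < C ∧ 0 < δ ∧ ∀ (m2 : ℝ), 0 < m2 → m2 ≤ m0sq →
      ∀ (i : KSliceIdx d) (μ : Fin (d + 1)) (x' y' : Tor (fine (L ^ i.n * L ^ i.j) (ksU L i))),
      |ksDSlice' L a m2 i μ x' y' - ksDSlice L a m2 i μ (underPtN L i.j i.n (ksU L i) x') (underPtN L i.j i.n (ksU L i) y')|
        ≤ C * (((L : ℝ) ^ (-(γ / 2))) ^ i.j)
          * Real.exp (-(δ * tdistT (ksU L i) (blockOf (L ^ i.j) (ksU L i) (underPtN L i.j i.n (ksU L i) x'))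
              (blockOf (L ^ i.j) (ksU L i) (underPtN L i.j i.n (ksU L i) y')))) := by
  have hL1 : 1 ≤ L := by omega
  obtain ⟨δ₀, cH, hδ₀, hcH, Hdec⟩ := ksH_decay_unif (d := d) L hLodd hL ha hm0
  obtain ⟨R, δ₁, hR, hδ₁, Hrate⟩ := ksH_rate_unif (d := d) L hLodd hL ha hm0 hγ0 hγ1.le
  obtain ⟨δ₂, cD, hδ₂, hcD, Ddec⟩ := ksDH_decay_unif (d := d) L hLodd hL ha hm0
  obtain ⟨RD, δ₃, hRD, hδ₃, Drate⟩ := ksDH_rate_unif (d := d) L hLodd hL ha hm0 hγ0 hγ1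
  have hcC := ksC_const_pos (d := d) L hL ha
  obtain ⟨hκ', _⟩ := kapCT_pos_le (d := d + 1) ha hL
  have hδ45 := delta45_pos (d := d + 1) ha hL
  have hK45 := K45_nonneg (d := d + 1) a L
  obtain ⟨κ, hκ, hκ₀, hκ₁, hκ₂, hκ₃, hκC, hκ45⟩ : ∃ κ : ℝ, 0 < κ ∧ κ ≤ δ₀ ∧ κ ≤ δ₁ ∧ κ ≤ δ₂ ∧ κ ≤ δ₃ ∧
      κ ≤ kapCT (d + 1) a L ∧ κ ≤ delta45 (d + 1) a L := by
    refine ⟨min (min (min δ₀ δ₁) (min δ₂ δ₃)) (min (kapCT (d + 1) a L) (delta45 (d + 1) a L)),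
      lt_min (lt_min (lt_min hδ₀ hδ₁) (lt_min hδ₂ hδ₃)) (lt_min hκ' hδ45), ?_, ?_, ?_, ?_, ?_, ?_⟩
    · exact (min_le_left _ _).trans ((min_le_left _ _).trans (min_le_left _ _))
    · exact (min_le_left _ _).trans ((min_le_left _ _).trans (min_le_right _ _))
    · exact (min_le_left _ _).trans ((min_le_right _ _).trans (min_le_left _ _))
    · exact (min_le_left _ _).trans ((min_le_right _ _).trans (min_le_right _ _))
    · exact (min_le_right _ _).trans (min_le_left _ _)
    · exact (min_le_right _ _).trans (min_le_right _ _)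
  have hs : 0 ≤ (L : ℝ) ^ (-(γ / 2)) := Real.rpow_nonneg (Nat.cast_nonneg _) _
  refine ⟨(RD * (gam0L (d + 1) a L - (kingRho (d + 1) a L + kingRhoB (d + 1) a L))⁻¹ * cH
        + cD * K45 (d + 1) a L * cH + cD * (gam0L (d + 1) a L - (kingRho (d + 1) a L + kingRhoB (d + 1) a L))⁻¹ * R)
      * latticeConst (d + 1) (κ / 2) ^ 2 + 1, κ / 2, by positivity, half_pos hκ, fun m2 hm hcap i μ x' y' => ?_⟩
  set cC : ℝ := (gam0L (d + 1) a L - (kingRho (d + 1) a L + kingRhoB (d + 1) a L))⁻¹ with hcC_def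
  set V : ℝ := latticeConst (d + 1) (κ / 2) with hV_def
  set s : ℝ := (L : ℝ) ^ (-(γ / 2)) with hs_def
  set x := underPtN L i.j i.n (ksU L i) x' with hx
  set y := underPtN L i.j i.n (ksU L i) y' with hy
  set Bx := blockOf (L ^ i.j) (ksU L i) x with hBx
  set By := blockOf (L ^ i.j) (ksU L i) y with hBy
  have hBy' : blockOf (L ^ i.n * L ^ i.j) (ksU L i) y' = By := (blockOf_underPtN L i.j i.n (ksU L i) y').symm
  have ht0 := tdistT_nonneg (ksU L i)
  have hRs : 0 ≤ R * s ^ i.j := mul_nonneg hR.le (pow_nonneg hs _)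
  have hRDs : 0 ≤ RD * s ^ i.j := mul_nonneg hRD.le (pow_nonneg hs _)
  have hKL : 0 ≤ K45 (d + 1) a L * ((L : ℝ) ^ i.j)⁻¹ := mul_nonneg hK45 (inv_nonneg.mpr (pow_nonneg (Nat.cast_nonneg (α := ℝ) L) i.j))
  have exp_rate_mono : ∀ {κ' r t : ℝ}, κ' ≤ r → 0 ≤ t → Real.exp (-(r * t)) ≤ Real.exp (-(κ' * t)) :=
    fun hκr ht => Real.exp_le_exp.mpr (neg_le_neg (mul_le_mul_of_nonneg_right hκr ht))
  have hA : ∀ z, |ksDH L a m2 i μ x z| ≤ cD * Real.exp (-(κ * tdistT (ksU L i) Bx z)) := fun z =>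
    ((Ddec m2 hm.le hcap i μ).1 x z).trans (mul_le_mul_of_nonneg_left (exp_rate_mono hκ₂ (ht0 _ _)) hcD.le)
  have hB' : ∀ w, |ksH' L a m2 i y' w| ≤ cH * Real.exp (-(κ * tdistT (ksU L i) w By)) := fun w => by
    rw [tdistT_symm, ← hBy']
    exact ((Hdec m2 hm.le hcap i).2 y' w).trans (mul_le_mul_of_nonneg_left (exp_rate_mono hκ₀ (ht0 _ _)) hcH.le)
  have hCm : ∀ z w, |ksC L a m2 i z w| ≤ cC * Real.exp (-(κ * tdistT (ksU L i) z w)) := fun z w =>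
    ((ksC_decay L hL ha hm i z w).1).trans (mul_le_mul_of_nonneg_left (exp_rate_mono hκC (ht0 _ _)) hcC.le)
  have hCm' : ∀ z w, |ksC' L a m2 i z w| ≤ cC * Real.exp (-(κ * tdistT (ksU L i) z w)) := fun z w =>
    ((ksC_decay L hL ha hm i z w).2).trans (mul_le_mul_of_nonneg_left (exp_rate_mono hκC (ht0 _ _)) hcC.le)
  have hdA : ∀ z, |ksDH' L a m2 i μ x' z - ksDH L a m2 i μ x z| ≤ RD * s ^ i.j * Real.exp (-(κ * tdistT (ksU L i) Bx z)) :=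
    fun z => (Drate m2 hm hcap i μ x' z).trans (mul_le_mul_of_nonneg_left (exp_rate_mono hκ₃ (ht0 _ _)) hRDs)
  have hdB : ∀ w, |ksH' L a m2 i y' w - ksH L a m2 i y w| ≤ R * s ^ i.j * Real.exp (-(κ * tdistT (ksU L i) w By)) := fun w => by
    rw [tdistT_symm]
    exact (Hrate m2 hm hcap i y' w).trans (mul_le_mul_of_nonneg_left (exp_rate_mono hκ₁ (ht0 _ _)) hRs)
  have hdC : ∀ z w, |ksC' L a m2 i z w - ksC L a m2 i z w|
      ≤ K45 (d + 1) a L * ((L : ℝ) ^ i.j)⁻¹ * Real.exp (-(κ * tdistT (ksU L i) z w)) := fun z w =>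
    (ksC_rate L hL ha hm i z w).trans (mul_le_mul_of_nonneg_left (exp_rate_mono hκ45 (ht0 _ _)) hKL)
  have hVs : ∀ u : Tor (ksU L i), ∑ z, Real.exp (-(κ / 2 * tdistT (ksU L i) u z)) ≤ V := fun u =>
    tdistT_sumBound (ksU L i) (κ / 2) (half_pos hκ) u
  have key := triple_rate (tdistT (ksU L i)) ht0 (tdistT_triangle (ksU L i)) hκ.le hcD.le hRDs hcC.le hKL hcH.le hRs
    hA hCm hCm' hB' hdA hdC hdB hVs
  have hE : 0 ≤ Real.exp (-(κ / 2 * tdistT (ksU L i) Bx By)) := (Real.exp_pos _).le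
  have hV0 : 0 ≤ V ^ 2 := sq_nonneg _
  have hLj : ((L : ℝ) ^ i.j)⁻¹ ≤ s ^ i.j := inv_pow_le_rate_pow hL1 (by linarith) i.j
  have hsj : 0 ≤ s ^ i.j := pow_nonneg hs _
  have hKs : cD * (K45 (d + 1) a L * ((L : ℝ) ^ i.j)⁻¹) * cH ≤ cD * (K45 (d + 1) a L * s ^ i.j) * cH :=
    mul_le_mul_of_nonneg_right (mul_le_mul_of_nonneg_left (mul_le_mul_of_nonneg_left hLj hK45) hcD.le) hcH.le
  have hsum : RD * s ^ i.j * cC * cH + cD * (K45 (d + 1) a L * ((L : ℝ) ^ i.j)⁻¹) * cH + cD * cC * (R * s ^ i.j)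
      ≤ (RD * cC * cH + cD * K45 (d + 1) a L * cH + cD * cC * R) * s ^ i.j := by
    calc RD * s ^ i.j * cC * cH + cD * (K45 (d + 1) a L * ((L : ℝ) ^ i.j)⁻¹) * cH + cD * cC * (R * s ^ i.j)
        ≤ RD * s ^ i.j * cC * cH + cD * (K45 (d + 1) a L * s ^ i.j) * cH + cD * cC * (R * s ^ i.j) := by linarith [hKs]
      _ = (RD * cC * cH + cD * K45 (d + 1) a L * cH + cD * cC * R) * s ^ i.j := by ring
  calc |ksDSlice' L a m2 i μ x' y' - ksDSlice L a m2 i μ x y|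
      = |triple (ksDH' L a m2 i μ x') (ksC' L a m2 i) (ksH' L a m2 i y') - triple (ksDH L a m2 i μ x) (ksC L a m2 i) (ksH L a m2 i y)| :=
        rfl
    _ ≤ (RD * s ^ i.j * cC * cH + cD * (K45 (d + 1) a L * ((L : ℝ) ^ i.j)⁻¹) * cH + cD * cC * (R * s ^ i.j)) * V ^ 2
          * Real.exp (-(κ / 2 * tdistT (ksU L i) Bx By)) := key
    _ ≤ (RD * cC * cH + cD * K45 (d + 1) a L * cH + cD * cC * R) * s ^ i.j * V ^ 2 * Real.exp (-(κ / 2 * tdistT (ksU L i) Bx By)) :=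
        mul_le_mul_of_nonneg_right (mul_le_mul_of_nonneg_right hsum hV0) hE
    _ = (RD * cC * cH + cD * K45 (d + 1) a L * cH + cD * cC * R) * V ^ 2 * s ^ i.j * Real.exp (-(κ / 2 * tdistT (ksU L i) Bx By)) := by
        ring
    _ ≤ ((RD * cC * cH + cD * K45 (d + 1) a L * cH + cD * cC * R) * V ^ 2 + 1) * s ^ i.j
          * Real.exp (-(κ / 2 * tdistT (ksU L i) Bx By)) :=
        mul_le_mul_of_nonneg_right (mul_le_mul_of_nonneg_right (by linarith) hsj) hE

/-- **THE DECAY OF THE GRADIENT PIECE AT `A = 0`, ONE `(C, δ)` FOR ALL MASSES `0 < m² ≤ m₀²`, both runs**: `|ksDSlice_μ(x, y)| ≤ C·e^{−δ|B(x) − B(y)|_U}`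
and `|ksDSlice′_μ(x′, y′)| ≤ C·e^{−δ|B(x′) − B(y′)|_U}` (King's (3.63)-type decay of `∂^ηG_{(j)} = (∂^ηℋ_j)C^{(j)}ℋ_jᵀ` from the decay of its three
factors at the common rate; part M v1.1 `triple_decay`). [cite: King1986, Prop. 3.7 (3.63) p.663, (4.34) p.674, (4.41)–(4.42) p.675] -/
theorem ksDSlice_decay_unif (hLodd : Odd L) (hL : 2 ≤ L) {a : ℝ} (ha : 0 < a) {m0sq : ℝ} (hm0 : 0 ≤ m0sq) :
    ∃ C δ : ℝ, 0 < C ∧ 0 < δ ∧ ∀ (m2 : ℝ), 0 < m2 → m2 ≤ m0sq → ∀ (i : KSliceIdx d) (μ : Fin (d + 1)),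
      (∀ x y : Tor (fine (L ^ i.j) (ksU L i)),
        |ksDSlice L a m2 i μ x y|
          ≤ C * Real.exp (-(δ * tdistT (ksU L i) (blockOf (L ^ i.j) (ksU L i) x) (blockOf (L ^ i.j) (ksU L i) y)))) ∧
      (∀ x' y' : Tor (fine (L ^ i.n * L ^ i.j) (ksU L i)),
        |ksDSlice' L a m2 i μ x' y'|
          ≤ C * Real.exp (-(δ * tdistT (ksU L i) (blockOf (L ^ i.n * L ^ i.j) (ksU L i) x') (blockOf (L ^ i.n * L ^ i.j) (ksU L i) y')))) := by
  obtain ⟨δ₀, cH, hδ₀, hcH, Hdec⟩ := ksH_decay_unif (d := d) L hLodd hL ha hm0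
  obtain ⟨δ₂, cD, hδ₂, hcD, Ddec⟩ := ksDH_decay_unif (d := d) L hLodd hL ha hm0
  have hcC := ksC_const_pos (d := d) L hL ha
  obtain ⟨hκ', _⟩ := kapCT_pos_le (d := d + 1) ha hL
  obtain ⟨κ, hκ, hκ₀, hκ₂, hκC⟩ : ∃ κ : ℝ, 0 < κ ∧ κ ≤ δ₀ ∧ κ ≤ δ₂ ∧ κ ≤ kapCT (d + 1) a L :=
    ⟨min (min δ₀ δ₂) (kapCT (d + 1) a L), lt_min (lt_min hδ₀ hδ₂) hκ', (min_le_left _ _).trans (min_le_left _ _),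
      (min_le_left _ _).trans (min_le_right _ _), min_le_right _ _⟩
  set cC : ℝ := (gam0L (d + 1) a L - (kingRho (d + 1) a L + kingRhoB (d + 1) a L))⁻¹ with hcC_def
  refine ⟨cD * cC * cH * latticeConst (d + 1) (κ / 2) ^ 2 + 1, κ / 2, by positivity, half_pos hκ, fun m2 hm hcap i μ => ?_⟩
  have ht0 := tdistT_nonneg (ksU L i)
  have exp_rate_mono : ∀ {κ' r t : ℝ}, κ' ≤ r → 0 ≤ t → Real.exp (-(r * t)) ≤ Real.exp (-(κ' * t)) :=
    fun hκr ht => Real.exp_le_exp.mpr (neg_le_neg (mul_le_mul_of_nonneg_right hκr ht))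
  have hVs : ∀ u : Tor (ksU L i), ∑ z, Real.exp (-(κ / 2 * tdistT (ksU L i) u z)) ≤ latticeConst (d + 1) (κ / 2) := fun u =>
    tdistT_sumBound (ksU L i) (κ / 2) (half_pos hκ) u
  have hV2 : cD * cC * cH * latticeConst (d + 1) (κ / 2) ^ 2 ≤ cD * cC * cH * latticeConst (d + 1) (κ / 2) ^ 2 + 1 := by linarith
  constructor
  · intro x y
    have hA : ∀ z, |ksDH L a m2 i μ x z| ≤ cD * Real.exp (-(κ * tdistT (ksU L i) (blockOf (L ^ i.j) (ksU L i) x) z)) := fun z =>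
      ((Ddec m2 hm.le hcap i μ).1 x z).trans (mul_le_mul_of_nonneg_left (exp_rate_mono hκ₂ (ht0 _ _)) hcD.le)
    have hB : ∀ w, |ksH L a m2 i y w| ≤ cH * Real.exp (-(κ * tdistT (ksU L i) w (blockOf (L ^ i.j) (ksU L i) y))) := fun w => by
      rw [tdistT_symm]
      exact ((Hdec m2 hm.le hcap i).1 y w).trans (mul_le_mul_of_nonneg_left (exp_rate_mono hκ₀ (ht0 _ _)) hcH.le)
    have hCm : ∀ z w, |ksC L a m2 i z w| ≤ cC * Real.exp (-(κ * tdistT (ksU L i) z w)) := fun z w =>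
      ((ksC_decay L hL ha hm i z w).1).trans (mul_le_mul_of_nonneg_left (exp_rate_mono hκC (ht0 _ _)) hcC.le)
    have key := triple_decay (tdistT (ksU L i)) ht0 (tdistT_triangle (ksU L i)) hκ.le hcD.le hcC.le hcH.le hA hCm hB hVs
    exact key.trans (mul_le_mul_of_nonneg_right hV2 (Real.exp_pos _).le)
  · intro x' y'
    have hA : ∀ z, |ksDH' L a m2 i μ x' z| ≤ cD * Real.exp (-(κ * tdistT (ksU L i) (blockOf (L ^ i.n * L ^ i.j) (ksU L i) x') z)) :=
      fun z => ((Ddec m2 hm.le hcap i μ).2 x' z).trans (mul_le_mul_of_nonneg_left (exp_rate_mono hκ₂ (ht0 _ _)) hcD.le)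
    have hB : ∀ w, |ksH' L a m2 i y' w| ≤ cH * Real.exp (-(κ * tdistT (ksU L i) w (blockOf (L ^ i.n * L ^ i.j) (ksU L i) y'))) :=
      fun w => by
        rw [tdistT_symm]
        exact ((Hdec m2 hm.le hcap i).2 y' w).trans (mul_le_mul_of_nonneg_left (exp_rate_mono hκ₀ (ht0 _ _)) hcH.le)
    have hCm : ∀ z w, |ksC' L a m2 i z w| ≤ cC * Real.exp (-(κ * tdistT (ksU L i) z w)) := fun z w =>
      ((ksC_decay L hL ha hm i z w).2).trans (mul_le_mul_of_nonneg_left (exp_rate_mono hκC (ht0 _ _)) hcC.le)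
    have key := triple_decay (tdistT (ksU L i)) ht0 (tdistT_triangle (ksU L i)) hκ.le hcD.le hcC.le hcH.le hA hCm hB hVs
    exact key.trans (mul_le_mul_of_nonneg_right hV2 (Real.exp_pos _).le)

/-! ## §2 The exact-mass datum with gradient: (3.73) line 2 at the physical masses, and NE2's site layer -/

/-- **THE EXACT-MASS DATUM WITH GRADIENT**: part I's `kSliceIndexD` (slice + gradient piece at two spacings, King's pairing `underPtN`) at the
member's PHYSICAL mass `physMass L m² i = m²(L^jη)²` — by part K its two kernels ARE King's slice `G^ε_{(j)}` of (2.17) and its forward η-derivative,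
for the fluctuation propagator with physical mass `m²`. [cite: King1986, (2.17) p.653, (2.20) p.654, Prop. 3.9 (3.73) p.665 (objects of lines 1–2)] -/
abbrev kSliceIndexPhysD (a m2 : ℝ) (hL : 2 ≤ L) (i : KSliceIdx d) : SlicesIndex (d + 1) :=
  kSliceIndexD L a (physMass L m2 i) hL i

/-- **(3.73) LINE 2 AT SLICE `j` FOR THE EXACT-MASS FAMILY — ONE `(C, δ)` FOR ALL VOLUMES, SLICES, RATIOS, DIRECTIONS (hence all member
masses)** (`0 ≤ γ < 1`, `γ′ = γ∕2`; every `d`): `|∂^{η′}_μG′_{(j)}(x′, y′) − ∂^η_μG_{(j)}(x, y)| ≤ C·L^{−γ′k}(L^jη)^{1−(d+1)−γ′}·e^{−δ(L^jη)^{−1}dist(x, y)}`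
— part I's `line2_kSlicesD` computation on §1's `ksDSlice_rate_unif` at the cap `m₀² = m²`. [cite: King1986, Prop. 3.9 (3.73) p.665 (second line, `A = 0`), (4.43) p.675, (2.20) p.654] -/
theorem line2_kSlicesPhys (hLodd : Odd L) (hL : 2 ≤ L) {a m2 : ℝ} (ha : 0 < a) (hm : 0 < m2) {γ : ℝ} (hγ0 : 0 ≤ γ) (hγ1 : γ < 1) :
    ∃ C δ : ℝ, 0 < C ∧ 0 < δ ∧ ∀ (i : KSliceIdx d) (x' y' : (kSliceDataD L a (physMass L m2 i) i).hi.S) (μ : Fin (d + 1)),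
      |(kSliceDataD L a (physMass L m2 i) i).hi.dG i.j μ x' y'
          - (kSliceDataD L a (physMass L m2 i) i).lo.dG i.j μ ((kSliceDataD L a (physMass L m2 i) i).pt x')
              ((kSliceDataD L a (physMass L m2 i) i).pt y')|
        ≤ C * ((kSliceDataD L a (physMass L m2 i) i).lo.L : ℝ) ^ (-(γ / 2 * (kSliceDataD L a (physMass L m2 i) i).lo.k))
          * ((kSliceDataD L a (physMass L m2 i) i).lo.slice i.j) ^ ((1 : ℝ) - ((d + 1 : ℕ) : ℝ) - γ / 2)
          * Real.exp (-(δ * ((kSliceDataD L a (physMass L m2 i) i).lo.slice i.j)⁻¹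
              * (kSliceDataD L a (physMass L m2 i) i).lo.dist ((kSliceDataD L a (physMass L m2 i) i).pt x')
                ((kSliceDataD L a (physMass L m2 i) i).pt y'))) := by
  have hL0 : 0 < L := by omega
  obtain ⟨C, δ, hC, hδ, H⟩ := ksDSlice_rate_unif (d := d) L hLodd hL ha hm.le hγ0 hγ1
  refine ⟨C, δ, hC, hδ, fun i x' y' μ => ?_⟩
  have h := H (physMass L m2 i) (physMass_pos L hm i) (physMass_le L (by omega) hm.le i) i μ x' y'
  have hsl : (kSliceDataD L a (physMass L m2 i) i).lo.slice i.j = (L : ℝ) ^ i.j * eps L i.k := rfl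
  obtain ⟨hsl0, hsl1⟩ := kSlice_slice_pos_le_one (L := L) (by omega) (le_of_lt i.j_succ_le_k)
  set sl : ℝ := (L : ℝ) ^ i.j * eps L i.k with hsl_def
  set t : ℝ := tdistT (ksU L i) (blockOf (L ^ i.j) (ksU L i) (underPtN L i.j i.n (ksU L i) x'))
    (blockOf (L ^ i.j) (ksU L i) (underPtN L i.j i.n (ksU L i) y')) with ht
  have hexp : Real.exp (-(δ * sl⁻¹ * (sl * t))) = Real.exp (-(δ * t)) := by
    rw [mul_assoc, inv_mul_cancel_left₀ hsl0.ne']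
  have hrate : ((L : ℝ) ^ (-(γ / 2))) ^ i.j = (L : ℝ) ^ (-(γ / 2 * i.k)) * sl ^ (-(γ / 2)) :=
    (slice_rate_identity L hL0 (γ / 2) i.j i.k).symm
  have hd' : (1 : ℝ) - ((d + 1 : ℕ) : ℝ) - γ / 2 ≤ -(γ / 2) := by
    have : (0 : ℝ) ≤ d := Nat.cast_nonneg d
    push_cast
    linarith
  have hpref : sl ^ (-(γ / 2)) ≤ sl ^ ((1 : ℝ) - ((d + 1 : ℕ) : ℝ) - γ / 2) :=
    Real.rpow_le_rpow_of_exponent_ge hsl0 hsl1 hd'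
  have hLk : 0 ≤ (L : ℝ) ^ (-(γ / 2 * i.k)) := Real.rpow_nonneg (Nat.cast_nonneg _) _
  rw [hsl, hexp]
  calc |ksDSlice' L a (physMass L m2 i) i μ x' y'
          - ksDSlice L a (physMass L m2 i) i μ (underPtN L i.j i.n (ksU L i) x') (underPtN L i.j i.n (ksU L i) y')|
      ≤ C * ((L : ℝ) ^ (-(γ / 2))) ^ i.j * Real.exp (-(δ * t)) := h
    _ = C * ((L : ℝ) ^ (-(γ / 2 * i.k)) * sl ^ (-(γ / 2))) * Real.exp (-(δ * t)) := by rw [hrate]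
    _ ≤ C * ((L : ℝ) ^ (-(γ / 2 * i.k)) * sl ^ ((1 : ℝ) - ((d + 1 : ℕ) : ℝ) - γ / 2)) * Real.exp (-(δ * t)) :=
        mul_le_mul_of_nonneg_right (mul_le_mul_of_nonneg_left (mul_le_mul_of_nonneg_left hpref hLk) hC.le) (Real.exp_pos _).le
    _ = C * (L : ℝ) ^ (-(γ / 2 * i.k)) * sl ^ ((1 : ℝ) - ((d + 1 : ℕ) : ℝ) - γ / 2) * Real.exp (-(δ * t)) := by ring

/-- **(3.73) LINE 1 for the exact-mass datum with gradient** (its slice kernel is part M's exact-mass member: `line1_kSlicesPhys`; `d ≥ 1`,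
`0 ≤ γ ≤ 1`). [cite: King1986, Prop. 3.9 (3.73) p.665 (first line, `A = 0`), (2.20) p.654] -/
theorem line1_kSlicesPhysD (hd : 1 ≤ d) (hLodd : Odd L) (hL : 2 ≤ L) {a m2 : ℝ} (ha : 0 < a) (hm : 0 < m2) {γ : ℝ} (hγ0 : 0 ≤ γ)
    (hγ1 : γ ≤ 1) :
    ∃ C δ : ℝ, 0 < C ∧ 0 < δ ∧ ∀ (i : KSliceIdx d) (x' y' : (kSliceDataD L a (physMass L m2 i) i).hi.S),
      |(kSliceDataD L a (physMass L m2 i) i).hi.G i.j x' y'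
          - (kSliceDataD L a (physMass L m2 i) i).lo.G i.j ((kSliceDataD L a (physMass L m2 i) i).pt x')
              ((kSliceDataD L a (physMass L m2 i) i).pt y')|
        ≤ C * ((kSliceDataD L a (physMass L m2 i) i).lo.L : ℝ) ^ (-(γ / 2 * (kSliceDataD L a (physMass L m2 i) i).lo.k))
          * ((kSliceDataD L a (physMass L m2 i) i).lo.slice i.j) ^ ((2 : ℝ) - ((d + 1 : ℕ) : ℝ) - γ / 2)
          * Real.exp (-(δ * ((kSliceDataD L a (physMass L m2 i) i).lo.slice i.j)⁻¹
              * (kSliceDataD L a (physMass L m2 i) i).lo.dist ((kSliceDataD L a (physMass L m2 i) i).pt x')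
                ((kSliceDataD L a (physMass L m2 i) i).pt y'))) :=
  line1_kSlicesPhys L hd hLodd hL ha hm hγ0 hγ1

/-- **`NE2PlusSite (d+1) (−1) c35` FOR THE GRADIENT OF EVERY SLICE OF KING'S (2.17) AT ITS PHYSICAL MASS, HYPOTHESIS-FREE, ONE `(C, δ)` FOR THE
WHOLE FAMILY** (`0 < γ < 1`; every `c35`, every `d`): part E v1.1 `ne2PlusSite_slicesDG_of_line2` fed `line2_kSlicesPhys` — NE2's `p = −1`
site-kernel layer (the gradient of a covariance slice) for the (2.17) decomposition of the `A = 0` fluctuation propagator with its (2.20) mass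
bookkeeping.  HONEST SCOPE: `A = 0`, one-point backgrounds, lattice units, NOT the sum over slices, NOT a discharge.
[cite: King1986, (2.17) p.653, (2.20) p.654, Prop. 3.9 (3.73) p.665 (second line); Balaban1985BackgroundPropagators, Thm 3.2 (3.48) p.398 + Thm 3.14 pp.426–427 (quantifier template)] -/
theorem ne2PlusSite_kSlicesPhys_grad (hLodd : Odd L) (hL : 2 ≤ L) {a m2 : ℝ} (ha : 0 < a) (hm : 0 < m2) {γ : ℝ} (hγ0 : 0 < γ)
    (hγ1 : γ < 1) (c35 : ℝ) :
    NE2PlusSite (d + 1) (-1) c35 (fun i : KSliceIdx d => slicesInstance (kSliceIndexPhysD L a m2 hL i))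
      (fun i => slicesDGSite (kSliceIndexPhysD L a m2 hL i)) := by
  obtain ⟨C, δ, hC, hδ, H⟩ := line2_kSlicesPhys (d := d) L hLodd hL ha hm hγ0.le hγ1
  exact ne2PlusSite_slicesDG_of_line2 (kSliceIndexPhysD L a m2 hL) (Nat.succ_pos d) hC hδ (half_pos hγ0) H c35

/-- `NE2ZeroSite (d+1) (−1)` for the exact-mass gradient slices (the site twin at the one configuration). [cite: King1986, Prop. 3.9 (3.73) p.665 (second line)] -/
theorem ne2ZeroSite_kSlicesPhys_grad (hLodd : Odd L) (hL : 2 ≤ L) {a m2 : ℝ} (ha : 0 < a) (hm : 0 < m2) {γ : ℝ} (hγ0 : 0 < γ)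
    (hγ1 : γ < 1) :
    NE2ZeroSite (d + 1) (-1) (fun i : KSliceIdx d => slicesInstance (kSliceIndexPhysD L a m2 hL i))
      (fun i => slicesDGSite (kSliceIndexPhysD L a m2 hL i)) :=
  ne2ZeroSite_of_ne2PlusSite (c35 := 0) (fun _ _ _ => trivial) (ne2PlusSite_kSlicesPhys_grad L hLodd hL ha hm hγ0 hγ1 0)

/-- `NE2PlusSite (d+1) (−2) c35` for the slice kernel of the exact-mass datum with gradient (`d ≥ 1`, `0 < γ ≤ 1`). [cite: King1986, Prop. 3.9 (3.73) p.665 (first line); Balaban1985BackgroundPropagators, Thm 3.2 (3.48) p.398 + Thm 3.14 pp.426–427 (quantifier template)] -/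
theorem ne2PlusSite_kSlicesPhysD (hd : 1 ≤ d) (hLodd : Odd L) (hL : 2 ≤ L) {a m2 : ℝ} (ha : 0 < a) (hm : 0 < m2) {γ : ℝ}
    (hγ0 : 0 < γ) (hγ1 : γ ≤ 1) (c35 : ℝ) :
    NE2PlusSite (d + 1) (-2) c35 (fun i : KSliceIdx d => slicesInstance (kSliceIndexPhysD L a m2 hL i))
      (fun i => slicesGSite (kSliceIndexPhysD L a m2 hL i)) := by
  obtain ⟨C, δ, hC, hδ, H⟩ := line1_kSlicesPhysD (d := d) L hd hLodd hL ha hm hγ0.le hγ1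
  exact ne2PlusSite_slicesG_of_line1 (kSliceIndexPhysD L a m2 hL) hC hδ (half_pos hγ0) H c35

/-- **BOTH KERNEL LINES OF (3.73) AT THE PHYSICAL MASSES, AT ONCE** (`d ≥ 1`, `0 < γ < 1`): NE2's site layer for the slice (`p = −2`) AND its gradient
(`p = −1`) for every slice of King's decomposition (2.17) of the `A = 0` fluctuation propagator at its physical mass — the model analogue of the two
kernel lines of Prop. 3.9 decided, hypothesis-free, with the (2.20) mass bookkeeping. [cite: King1986, (2.17) p.653, (2.20) p.654, Prop. 3.9 (3.73) p.665 (lines 1–2)] -/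
theorem ne2PlusSite_kSlicesPhys_both (hd : 1 ≤ d) (hLodd : Odd L) (hL : 2 ≤ L) {a m2 : ℝ} (ha : 0 < a) (hm : 0 < m2) {γ : ℝ}
    (hγ0 : 0 < γ) (hγ1 : γ < 1) (c35 : ℝ) :
    NE2PlusSite (d + 1) (-2) c35 (fun i : KSliceIdx d => slicesInstance (kSliceIndexPhysD L a m2 hL i))
        (fun i => slicesGSite (kSliceIndexPhysD L a m2 hL i)) ∧
      NE2PlusSite (d + 1) (-1) c35 (fun i : KSliceIdx d => slicesInstance (kSliceIndexPhysD L a m2 hL i))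
        (fun i => slicesDGSite (kSliceIndexPhysD L a m2 hL i)) :=
  ⟨ne2PlusSite_kSlicesPhysD L hd hLodd hL ha hm hγ0 hγ1.le c35, ne2PlusSite_kSlicesPhys_grad L hLodd hL ha hm hγ0 hγ1 c35⟩

end Summit.QuantumFields.YangMills.BalabanUVNodes.N15KingModelRung.Curved
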